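import Literature.NumberTheory.Rogawski1990.ArchSmoothAmbientLift             -- ★ 3A p841442: `ArchSmooth₂.exists_contDiff` (ambient `Θ₃`), `ArchSmooth₂.hasCompactSupport`
import Literature.NumberTheory.Automorphic.ArchEndoscopicDiagonalCongruence      -- ★ (R3-a) p841011: the 2-block congruence frame `(T, ψ, hψ)`
import Literature.NumberTheory.Automorphic.ArchDiagonalTorus                    -- ★ D1′b: `archDiagTorus`, `norm_embedding_eq_one_of_complexConj_mul_self`
import Literature.NumberTheory.Automorphic.ArchStableClassRegularTorus           -- ★ (V8)-glob: `archPiEquivCM_archDiagTorus`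
import Literature.NumberTheory.Automorphic.ArchEndoscopicTorusCayleyFrame          -- ★ B-p12 (V9): `circleDiagonal_mem_archLocal_antidiagOne` (the frozen `U(Φ₁)`-coordinate of the STEP-3 skeleton)
import Literature.NumberTheory.Automorphic.ArchCongruenceTransport              -- ★ p06: `conj_smul_one_eq` (a congruence fixes scalars)
import Literature.NumberTheory.Rogawski1990.GlobalTransferFactor                 -- ★ `cmRationalToArch` (`γ ↦ γ ⊗ 1` on the `cmDatum` rational carrier)
import HarnessLib

/-!
# The 2-BLOCK TEST FUNCTION of Lemma 14.5.2 (c) at `∞`: an `ArchSmooth₂` function `aH` on `H_∞ = U(Φ₂)_∞ × U(Φ₁)_∞`, with the `U(Φ₁)`-coordinate frozen at `δ` and the 2-block read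
# through the congruence `ψ : U(Φ₂)_∞ ≃ₜ* U(diag α)_∞`, IS the restriction of an ambient smooth `Θ₂ : M₂(L ⊗ ℝ) → ℂ` compactly supported on the group (Rogawski 1990 §14.3, p. 238)

Topic `NumberTheory/Rogawski1990`; namespace `Literature.NumberTheory.Rogawski1990` (§2) and `Literature.NumberTheory.Automorphic` (§1, ambient linear algebra).  THEOREMS ONLY (no `def`, no
instance, no notation, no axiom, no named fact, no `sorry`).  Cell `pub/hodgecm-mathlib`, ENGINE T1 (crux H413 = `stmt-HodgeConjecture-24833`); ROAD-Sd residual R3 «(S-c) central vanishing»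
(`stub_ScCore` of `Cruxes/H413/Lines/F0_P3a_SdArch.lean`), STEP-3 node **(3A′) «THE 2-BLOCK TEST FUNCTION»** of the integration map `CENSUS-R3-STEP3-Integration.F0P3a-p03g10.md` (b54b3c40;
pen of record ad interim F0P3a-p02 (g11) by LEAD WORD T8-86); author F0P3a-p02 (g11), 2026-09-01.

WHY.  The descent ★ `ArchEndoscopicCentralDescent` ((E2), p841432) and ★ (3D) p841544 eat an ambient test function `Θ : M₂(L ⊗ ℝ) → E` with `hΘ : ContDiff ℝ ⊤ Θ` and
`hΘc : HasCompactSupport (fun g : U(diag α)_∞ => Θ ↑↑g)`, integrated as `o ↦ Θ ↑↑(e⁻¹ o)`; the `H`-side bookkeeping ★ (3H) p841703 delivers the integrand `o ↦ aH (ψ⁻¹ e⁻¹ o, δ)`.  This file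
produces `Θ₂` with `Θ₂ ↑↑k = aH (ψ⁻¹ k, δ)` for every `k ∈ U(diag α)_∞`: from ★ 3A `ArchSmooth₂.exists_contDiff` (`aH = Θ₃ ∘ ↑ ∘ ι_∞`, `Θ₃` smooth on `M₃(L ⊗ ℝ)`) compose with the AFFINE map
`X ↦ ι(T⁻¹ X T ⊕ δ)` = `reindex endoPerm endoPerm (fromBlocks (T⁻¹XT) 0 0 ↑↑δ)` (the endoscopic pattern ★ `coe_endoGL` with the congruence un-done, ★ `hψ`), which is smooth (linear + constant on a
finite-dimensional space); compact support on the group is that of `aH` (★ `ArchSmooth₂.hasCompactSupport`) carried by the homeomorphism `ψ`.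

WHAT IS PROVED.
§1 `contDiff_reindex_fromBlocks_conj` — `X ↦ reindex endoPerm endoPerm (fromBlocks (T⁻¹ X T) 0 0 D)` is `C^∞` on `M₂(L ⊗ ℝ)` (scoped operator norms, the cell's ambient-smooth convention).
§2 `coe_coe_symm_eq_of_coe_eq` (`↑(ψ⁻¹ k) = T⁻¹ ↑k T` from `hψ`), `coe_endoEmbArch_symm_eq_reindex` (the matrix of `ι_∞(ψ⁻¹ k, δ)` IS the affine image of `↑↑k`),
   **`ArchSmooth₂.exists_contDiff_twoBlock`**: `∃ Θ₂, ContDiff ℝ ∞ Θ₂ ∧ HasCompactSupport (fun g : U(diag α)_∞ => Θ₂ ↑↑g) ∧ ∀ k, Θ₂ ↑↑k = aH (ψ.symm k, δ)` — (E2)'s `(Θ, hΘ, hΘc)` binders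
   with the bridge to ★ (3H)'s integrand; `ArchSmooth₂.exists_contDiff_twoBlock_apply_symm` (the same bridge read at `o ∈ Π_w G_w`: `Θ₂ ↑↑(e⁻¹ o) = aH (ψ⁻¹ e⁻¹ o, δ)`).
§3 the centre `γ_H = (ζ•1₂, ζ•1₁)` of `stub_ScCore`: `complexConj_mul_self_eq_one_of_coe_eq_smul_one` (`ζ̄ζ = 1`), `norm_embedding_eq_one_of_coe_eq_smul_one` (`|σ_w ζ| = 1`),
   **`cmRationalToArch_one_eq_symm_circleDiagonal_of_coe_eq_smul_one`** (`(ζ•1₁) ⊗ 1 = e₁⁻¹(w ↦ diag(σ_w ζ))`: the skeleton's frozen `δ`) and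
   **`congr_cmRationalToArch_two_eq_archDiagTorus_of_coe_eq_smul_one`** (`ψ((ζ•1₂) ⊗ 1) = t(w ↦ (σ_w ζ, σ_w ζ))`: the point at which ★ (3D) evaluates `Θ₂`, via ★ `archDiagTorus_eq_symm_apply`).
HONEST LABEL: HC_CM is proved only modulo the 7 printed citations until rung 0 closes; this file is bookkeeping and pays nothing by itself.

## References
* [Rogawski1990] J. D. Rogawski, *Automorphic Representations of Unitary Groups in Three Variables*, Ann. of Math. Stud. 123 (1990), §14.3 p. 234 (`f′^H_∞` of compact support on `H_∞`), §4.8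
  Case (a) p. 53 (the pattern `(* 0 *; 0 * 0; * 0 *)`), §14.5 Lemma 14.5.2 (c) p. 238.
* [BorelJacquet1979] A. Borel, H. Jacquet, *Automorphic forms and automorphic representations*, PSPM 33.1 (1979), §4.1 (`C_c^∞(G_∞)`).
-/

set_option autoImplicit false

noncomputable section

open NumberField NumberField.InfinitePlace NumberField.mixedEmbedding Topology Filter Set Function
-- `Classical` is needed to see the Mathlib normed-space instances on `mixedSpace L` (note H5 of ★ `AdelicGLnGlue`); operator norms = the cell's ambient-smooth convention
open scoped Matrix MatrixGroups Matrix.Norms.Operator ContDiff Classical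

/-! ## §1 The affine 2-block embedding `X ↦ ι(T⁻¹ X T ⊕ D)` is smooth -/

namespace Literature.NumberTheory.Automorphic

open Literature.NumberTheory.Rogawski1990 (endoPerm)

section Ambient

variable {L : Type} [Field L] [NumberField L]

/-- **`X ↦ reindex endoPerm endoPerm (fromBlocks (T⁻¹ X T) 0 0 D)` is `C^∞` on `M₂(L ⊗ ℝ)`**: a linear map of finite-dimensional real vector spaces plus a constant.
[cite: BorelJacquet1979, §4.1] [cite: Rogawski1990, §4.8 Case (a) p. 53] -/
theorem contDiff_reindex_fromBlocks_conj (T : GL (Fin 2) (mixedSpace L)) (D : Matrix (Fin 1) (Fin 1) (mixedSpace L)) :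
    ContDiff ℝ ∞ (fun X : Matrix (Fin 2) (Fin 2) (mixedSpace L) =>
      Matrix.reindex endoPerm endoPerm (Matrix.fromBlocks (((T⁻¹ : GL (Fin 2) (mixedSpace L)) : Matrix (Fin 2) (Fin 2) (mixedSpace L)) * X *
        (T : Matrix (Fin 2) (Fin 2) (mixedSpace L))) 0 0 D)) := by
  haveI : FiniteDimensional ℝ (Matrix (Fin 2) (Fin 2) (mixedSpace L)) := Module.Finite.matrix
  -- the linear part
  let Lm : Matrix (Fin 2) (Fin 2) (mixedSpace L) →ₗ[ℝ] Matrix (Fin 3) (Fin 3) (mixedSpace L) :=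
    { toFun := fun X => Matrix.reindex endoPerm endoPerm (Matrix.fromBlocks (((T⁻¹ : GL (Fin 2) (mixedSpace L)) : Matrix (Fin 2) (Fin 2) (mixedSpace L)) * X *
        (T : Matrix (Fin 2) (Fin 2) (mixedSpace L))) 0 0 (0 : Matrix (Fin 1) (Fin 1) (mixedSpace L)))
      map_add' := fun X Y => by
        simp only [Matrix.reindex_apply, Matrix.mul_add, Matrix.add_mul]
        rw [show Matrix.fromBlocks (((T⁻¹ : GL (Fin 2) (mixedSpace L)) : Matrix (Fin 2) (Fin 2) (mixedSpace L)) * X * (T : Matrix (Fin 2) (Fin 2) (mixedSpace L)) +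
              ((T⁻¹ : GL (Fin 2) (mixedSpace L)) : Matrix (Fin 2) (Fin 2) (mixedSpace L)) * Y * (T : Matrix (Fin 2) (Fin 2) (mixedSpace L)))
              (0 : Matrix (Fin 2) (Fin 1) (mixedSpace L)) (0 : Matrix (Fin 1) (Fin 2) (mixedSpace L)) (0 : Matrix (Fin 1) (Fin 1) (mixedSpace L)) =
            Matrix.fromBlocks (((T⁻¹ : GL (Fin 2) (mixedSpace L)) : Matrix (Fin 2) (Fin 2) (mixedSpace L)) * X * (T : Matrix (Fin 2) (Fin 2) (mixedSpace L))) 0 0 0 +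
              Matrix.fromBlocks (((T⁻¹ : GL (Fin 2) (mixedSpace L)) : Matrix (Fin 2) (Fin 2) (mixedSpace L)) * Y * (T : Matrix (Fin 2) (Fin 2) (mixedSpace L))) 0 0 0 by
            simp only [Matrix.fromBlocks_add, add_zero],
          Matrix.submatrix_add]
        rfl
      map_smul' := fun c X => by
        simp only [Matrix.reindex_apply, RingHom.id_apply, Matrix.mul_smul, Matrix.smul_mul]
        rw [show Matrix.fromBlocks (c • (((T⁻¹ : GL (Fin 2) (mixedSpace L)) : Matrix (Fin 2) (Fin 2) (mixedSpace L)) * X * (T : Matrix (Fin 2) (Fin 2) (mixedSpace L))))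
              (0 : Matrix (Fin 2) (Fin 1) (mixedSpace L)) (0 : Matrix (Fin 1) (Fin 2) (mixedSpace L)) (0 : Matrix (Fin 1) (Fin 1) (mixedSpace L)) =
            c • Matrix.fromBlocks (((T⁻¹ : GL (Fin 2) (mixedSpace L)) : Matrix (Fin 2) (Fin 2) (mixedSpace L)) * X * (T : Matrix (Fin 2) (Fin 2) (mixedSpace L))) 0 0 0 by
            simp only [Matrix.fromBlocks_smul, smul_zero],
          Matrix.submatrix_smul]
        rfl }
  have hLsmooth : ContDiff ℝ ∞ (Lm : Matrix (Fin 2) (Fin 2) (mixedSpace L) → Matrix (Fin 3) (Fin 3) (mixedSpace L)) :=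
    (⟨Lm, Lm.continuous_of_finiteDimensional⟩ : Matrix (Fin 2) (Fin 2) (mixedSpace L) →L[ℝ] Matrix (Fin 3) (Fin 3) (mixedSpace L)).contDiff
  -- plus the constant block
  have heq : (fun X : Matrix (Fin 2) (Fin 2) (mixedSpace L) =>
      Matrix.reindex endoPerm endoPerm (Matrix.fromBlocks (((T⁻¹ : GL (Fin 2) (mixedSpace L)) : Matrix (Fin 2) (Fin 2) (mixedSpace L)) * X *
        (T : Matrix (Fin 2) (Fin 2) (mixedSpace L))) 0 0 D)) =
      fun X => Lm X + Matrix.reindex endoPerm endoPerm (Matrix.fromBlocks (0 : Matrix (Fin 2) (Fin 2) (mixedSpace L)) 0 0 D) := by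
    funext X
    show _ = Matrix.reindex endoPerm endoPerm (Matrix.fromBlocks _ 0 0 0) + _
    rw [Matrix.reindex_apply, Matrix.reindex_apply, Matrix.reindex_apply,
      show Matrix.fromBlocks (((T⁻¹ : GL (Fin 2) (mixedSpace L)) : Matrix (Fin 2) (Fin 2) (mixedSpace L)) * X * (T : Matrix (Fin 2) (Fin 2) (mixedSpace L))) 0 0 D =
          Matrix.fromBlocks (((T⁻¹ : GL (Fin 2) (mixedSpace L)) : Matrix (Fin 2) (Fin 2) (mixedSpace L)) * X * (T : Matrix (Fin 2) (Fin 2) (mixedSpace L)))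
              (0 : Matrix (Fin 2) (Fin 1) (mixedSpace L)) (0 : Matrix (Fin 1) (Fin 2) (mixedSpace L)) (0 : Matrix (Fin 1) (Fin 1) (mixedSpace L)) +
            Matrix.fromBlocks 0 0 0 D by
        simp only [Matrix.fromBlocks_add, add_zero, zero_add],
      Matrix.submatrix_add]
    rfl
  rw [heq]
  exact hLsmooth.add contDiff_const

end Ambient

end Literature.NumberTheory.Automorphic

/-! ## §2 The 2-block test function -/

namespace Literature.NumberTheory.Rogawski1990

open Literature.NumberTheory.Automorphic Literature.NumberTheory.Automorphic.UnitaryGroup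
open Literature.AlgebraicGeometry.ShimuraVarieties (unitaryGroup mem_unitaryGroup_iff)

section TwoBlock

variable {L : Type} [Field L] [NumberField L] [IsCMField L] {α : Fin 2 → L} (T : GL (Fin 2) (mixedSpace L))
  (ψ : UnitaryGroup.arch (↥(maximalRealSubfield L)) L (IsCMField.complexConj L) 2 (Matrix.of fun i j : Fin 2 => if i.val + j.val + 1 = 2 then (1 : L) else 0) ≃ₜ*
    UnitaryGroup.arch (↥(maximalRealSubfield L)) L (IsCMField.complexConj L) 2 (Matrix.diagonal α))
  (hψ : ∀ x, ((ψ x : UnitaryGroup.arch (↥(maximalRealSubfield L)) L (IsCMField.complexConj L) 2 (Matrix.diagonal α)) : GL (Fin 2) (mixedSpace L)) =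
    T * (x : GL (Fin 2) (mixedSpace L)) * T⁻¹)

include hψ in
/-- `ψ⁻¹` conjugates by `T⁻¹`: `↑(ψ⁻¹ k) = T⁻¹ · ↑k · T` (from `hψ` at `ψ⁻¹ k`). [cite: PlatonovRapinchuk1994, §2.3] -/
theorem coe_congr_symm_eq_of_coe_eq (k : UnitaryGroup.arch (↥(maximalRealSubfield L)) L (IsCMField.complexConj L) 2 (Matrix.diagonal α)) :
    ((ψ.symm k : UnitaryGroup.arch (↥(maximalRealSubfield L)) L (IsCMField.complexConj L) 2 (Matrix.of fun i j : Fin 2 => if i.val + j.val + 1 = 2 then (1 : L) else 0)) :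
        GL (Fin 2) (mixedSpace L)) = T⁻¹ * (k : GL (Fin 2) (mixedSpace L)) * T := by
  have h := hψ (ψ.symm k)
  rw [ContinuousMulEquiv.apply_symm_apply] at h
  rw [h]
  group

include hψ in
/-- **The matrix of `ι_∞(ψ⁻¹ k, δ)` is the affine 2-block image of `↑↑k`**: `↑↑(ι_∞(ψ⁻¹ k, δ)) = reindex endoPerm endoPerm (fromBlocks (T⁻¹·↑↑k·T) 0 0 ↑↑δ)` (★ `coe_endoEmbArch`, ★ `coe_endoGL`).
[cite: Rogawski1990, §4.8 Case (a) p. 53] -/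
theorem coe_endoEmbArch_symm_eq_reindex (k : UnitaryGroup.arch (↥(maximalRealSubfield L)) L (IsCMField.complexConj L) 2 (Matrix.diagonal α))
    (δ : UnitaryGroup.arch (↥(maximalRealSubfield L)) L (IsCMField.complexConj L) 1 (Matrix.of fun i j : Fin 1 => if i.val + j.val + 1 = 1 then (1 : L) else 0)) :
    (((endoEmbArch L (ψ.symm k, δ)).val : GL (Fin 3) (mixedSpace L)) : Matrix (Fin 3) (Fin 3) (mixedSpace L)) =
      Matrix.reindex endoPerm endoPerm (Matrix.fromBlocks (((T⁻¹ : GL (Fin 2) (mixedSpace L)) : Matrix (Fin 2) (Fin 2) (mixedSpace L)) *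
        ((k : GL (Fin 2) (mixedSpace L)) : Matrix (Fin 2) (Fin 2) (mixedSpace L)) * (T : Matrix (Fin 2) (Fin 2) (mixedSpace L))) 0 0
        ((δ : GL (Fin 1) (mixedSpace L)) : Matrix (Fin 1) (Fin 1) (mixedSpace L))) := by
  have h1 : (((ψ.symm k : UnitaryGroup.arch (↥(maximalRealSubfield L)) L (IsCMField.complexConj L) 2 (Matrix.of fun i j : Fin 2 => if i.val + j.val + 1 = 2 then (1 : L) else 0)) :
        GL (Fin 2) (mixedSpace L)) : Matrix (Fin 2) (Fin 2) (mixedSpace L)) =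
      ((T⁻¹ : GL (Fin 2) (mixedSpace L)) : Matrix (Fin 2) (Fin 2) (mixedSpace L)) * ((k : GL (Fin 2) (mixedSpace L)) : Matrix (Fin 2) (Fin 2) (mixedSpace L)) *
        (T : Matrix (Fin 2) (Fin 2) (mixedSpace L)) := by
    rw [coe_congr_symm_eq_of_coe_eq T ψ hψ k, Units.val_mul, Units.val_mul]
  rw [coe_endoEmbArch, coe_endoGL, ← h1]

include hψ in
/-- **(3A′) THE 2-BLOCK TEST FUNCTION.**  For `aH ∈ C_c^∞(H_∞)` (★ `ArchSmooth₂`), a congruence `ψ : U(Φ₂)_∞ ≃ₜ* U(diag α)_∞` conjugating by `T`, and a frozen `δ ∈ U(Φ₁)_∞`, there is an ambient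
`Θ₂ : M₂(L ⊗ ℝ) → ℂ`, `ContDiff ℝ ∞`, whose restriction to `U(diag α)_∞` has compact support and equals `k ↦ aH (ψ⁻¹ k, δ)` — EXACTLY the binders `(Θ) (hΘ) (hΘc)` of ★ (E2)
`sum_integral_pi_erase_eq_zero_of_eventuallyEq` ∕ ★ (3D), with the bridge to ★ (3H)'s integrand `o ↦ aH (ψ⁻¹ e⁻¹ o, δ)`.  (`Θ₂ = Θ₃ ∘ (X ↦ ι(T⁻¹XT ⊕ ↑↑δ))` for ★ 3A's ambient `Θ₃`.)
[cite: Rogawski1990, §14.3 p. 234; §14.5 Lemma 14.5.2 (c) p. 238] [cite: BorelJacquet1979, §4.1] -/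
theorem ArchSmooth₂.exists_contDiff_twoBlock
    {aH : (UnitaryGroup.arch (↥(maximalRealSubfield L)) L (IsCMField.complexConj L) 2 (Matrix.of fun i j : Fin 2 => if i.val + j.val + 1 = 2 then (1 : L) else 0) ×
      UnitaryGroup.arch (↥(maximalRealSubfield L)) L (IsCMField.complexConj L) 1 (Matrix.of fun i j : Fin 1 => if i.val + j.val + 1 = 1 then (1 : L) else 0)) → ℂ}
    (haH : ArchSmooth₂ L aH)
    (δ : UnitaryGroup.arch (↥(maximalRealSubfield L)) L (IsCMField.complexConj L) 1 (Matrix.of fun i j : Fin 1 => if i.val + j.val + 1 = 1 then (1 : L) else 0)) :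
    ∃ Θ : Matrix (Fin 2) (Fin 2) (mixedSpace L) → ℂ, ContDiff ℝ ∞ Θ ∧
      HasCompactSupport (fun g : UnitaryGroup.arch (↥(maximalRealSubfield L)) L (IsCMField.complexConj L) 2 (Matrix.diagonal α) =>
        Θ ((g : GL (Fin 2) (mixedSpace L)) : Matrix (Fin 2) (Fin 2) (mixedSpace L))) ∧
      ∀ k : UnitaryGroup.arch (↥(maximalRealSubfield L)) L (IsCMField.complexConj L) 2 (Matrix.diagonal α),
        Θ ((k : GL (Fin 2) (mixedSpace L)) : Matrix (Fin 2) (Fin 2) (mixedSpace L)) = aH (ψ.symm k, δ) := by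
  obtain ⟨Θ₃, hΘ₃, -, hΘ₃a⟩ := haH.exists_contDiff
  refine ⟨fun X => Θ₃ (Matrix.reindex endoPerm endoPerm (Matrix.fromBlocks (((T⁻¹ : GL (Fin 2) (mixedSpace L)) : Matrix (Fin 2) (Fin 2) (mixedSpace L)) * X *
      (T : Matrix (Fin 2) (Fin 2) (mixedSpace L))) 0 0 ((δ : GL (Fin 1) (mixedSpace L)) : Matrix (Fin 1) (Fin 1) (mixedSpace L)))),
    hΘ₃.comp (contDiff_reindex_fromBlocks_conj T _), ?_, ?_⟩
  · -- the restriction to the group is `k ↦ aH (ψ⁻¹ k, δ)`, compactly supported since `aH` is and `ψ` is a homeomorphism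
    have hfun : (fun g : UnitaryGroup.arch (↥(maximalRealSubfield L)) L (IsCMField.complexConj L) 2 (Matrix.diagonal α) =>
        Θ₃ (Matrix.reindex endoPerm endoPerm (Matrix.fromBlocks (((T⁻¹ : GL (Fin 2) (mixedSpace L)) : Matrix (Fin 2) (Fin 2) (mixedSpace L)) *
          ((g : GL (Fin 2) (mixedSpace L)) : Matrix (Fin 2) (Fin 2) (mixedSpace L)) * (T : Matrix (Fin 2) (Fin 2) (mixedSpace L))) 0 0
          ((δ : GL (Fin 1) (mixedSpace L)) : Matrix (Fin 1) (Fin 1) (mixedSpace L))))) =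
        fun g => aH (ψ.symm g, δ) := by
      funext g
      rw [hΘ₃a, coe_endoEmbArch_symm_eq_reindex T ψ hψ g δ]
    rw [hfun]
    refine HasCompactSupport.intro ((haH.hasCompactSupport.image continuous_fst).image ψ.continuous) fun g hg => ?_
    by_contra hne
    apply hg
    refine ⟨ψ.symm g, ⟨(ψ.symm g, δ), subset_tsupport _ (Function.mem_support.2 hne), rfl⟩, ?_⟩
    exact ψ.apply_symm_apply g
  · intro k
    rw [hΘ₃a, coe_endoEmbArch_symm_eq_reindex T ψ hψ k δ]

include hψ in
/-- The bridge read on `Π_w G_w`: `Θ₂ ↑↑(e⁻¹ o) = aH (ψ⁻¹ e⁻¹ o, δ)` — the LEFT side is ★ (E2)'s integrand, the RIGHT side ★ (3H)'s. [cite: Rogawski1990, §14.5 p. 238] [cite: BorelJacquet1979, §4.1] -/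
theorem ArchSmooth₂.exists_contDiff_twoBlock_apply_symm
    {aH : (UnitaryGroup.arch (↥(maximalRealSubfield L)) L (IsCMField.complexConj L) 2 (Matrix.of fun i j : Fin 2 => if i.val + j.val + 1 = 2 then (1 : L) else 0) ×
      UnitaryGroup.arch (↥(maximalRealSubfield L)) L (IsCMField.complexConj L) 1 (Matrix.of fun i j : Fin 1 => if i.val + j.val + 1 = 1 then (1 : L) else 0)) → ℂ}
    (haH : ArchSmooth₂ L aH)
    (δ : UnitaryGroup.arch (↥(maximalRealSubfield L)) L (IsCMField.complexConj L) 1 (Matrix.of fun i j : Fin 1 => if i.val + j.val + 1 = 1 then (1 : L) else 0)) :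
    ∃ Θ : Matrix (Fin 2) (Fin 2) (mixedSpace L) → ℂ, ContDiff ℝ ∞ Θ ∧
      HasCompactSupport (fun g : UnitaryGroup.arch (↥(maximalRealSubfield L)) L (IsCMField.complexConj L) 2 (Matrix.diagonal α) =>
        Θ ((g : GL (Fin 2) (mixedSpace L)) : Matrix (Fin 2) (Fin 2) (mixedSpace L))) ∧
      ∀ o : ∀ w : {w : InfinitePlace L // IsComplex w}, archLocal L 2 (Matrix.diagonal α) w,
        Θ ((((archPiEquivCM 2 L (Matrix.diagonal α)).symm o : UnitaryGroup.arch (↥(maximalRealSubfield L)) L (IsCMField.complexConj L) 2 (Matrix.diagonal α)) :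
            GL (Fin 2) (mixedSpace L)) : Matrix (Fin 2) (Fin 2) (mixedSpace L)) =
          aH (ψ.symm ((archPiEquivCM 2 L (Matrix.diagonal α)).symm o), δ) := by
  obtain ⟨Θ, hΘ, hΘc, hΘa⟩ := haH.exists_contDiff_twoBlock T ψ hψ δ
  exact ⟨Θ, hΘ, hΘc, fun o => hΘa _⟩

end TwoBlock

/-! ## §3 The centre: the rational central element `γ_H = (ζ•1₂, ζ•1₁)` of (S-c) sits at the constant torus point `zc_w = σ_w ζ` in both frames -/

section Centre

variable {L : Type} [Field L] [NumberField L] [IsCMField L]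

/-- **`ζ•1₁ ∈ U(Φ₁)(L⁺) ⇒ ζ̄ ζ = 1`** (the unitarity of a scalar: `Φ₁ = (1)`). [cite: Rogawski1990, §14.5 p. 239; §4.9 p. 54] -/
theorem complexConj_mul_self_eq_one_of_coe_eq_smul_one
    (γ₁ : (UnitaryGroup.cmDatum L 1 (Matrix.of fun i j : Fin 1 => if i.val + j.val + 1 = 1 then (1 : L) else 0)).Rational) {ζ : L}
    (hγ₁ : (((γ₁ : unitaryGroup (cmConjRingHom L) (Matrix.of fun i j : Fin 1 => if i.val + j.val + 1 = 1 then (1 : L) else 0)).val : GL (Fin 1) L) :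
      Matrix (Fin 1) (Fin 1) L) = ζ • (1 : Matrix (Fin 1) (Fin 1) L)) :
    (IsCMField.complexConj L ζ : L) * ζ = 1 := by
  have hmem := mem_unitaryGroup_iff.1 γ₁.2
  rw [hγ₁] at hmem
  have h00 := congrFun (congrFun hmem 0) 0
  simp [Matrix.mul_apply, Matrix.smul_apply, Matrix.one_apply, Matrix.map_apply, cmConjRingHom_apply] at h00
  simpa [mul_comm] using h00

/-- The central angles `zc_w := σ_w ζ ∈ S¹` of a unitary scalar. [cite: Rogawski1990, §14.5 p. 239] -/
theorem norm_embedding_eq_one_of_coe_eq_smul_one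
    (γ₁ : (UnitaryGroup.cmDatum L 1 (Matrix.of fun i j : Fin 1 => if i.val + j.val + 1 = 1 then (1 : L) else 0)).Rational) {ζ : L}
    (hγ₁ : (((γ₁ : unitaryGroup (cmConjRingHom L) (Matrix.of fun i j : Fin 1 => if i.val + j.val + 1 = 1 then (1 : L) else 0)).val : GL (Fin 1) L) :
      Matrix (Fin 1) (Fin 1) L) = ζ • (1 : Matrix (Fin 1) (Fin 1) L)) (w : {w : InfinitePlace L // IsComplex w}) :
    ‖w.1.embedding ζ‖ = 1 :=
  norm_embedding_eq_one_of_complexConj_mul_self L ζ (complexConj_mul_self_eq_one_of_coe_eq_smul_one γ₁ hγ₁) w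

/-- **THE `U(Φ₁)`-COMPONENT OF THE CENTRE IN B-p12's FRAME**: `(ζ•1₁) ⊗ 1 = e₁⁻¹ (w ↦ diag(σ_w ζ))` in `U(Φ₁)(L ⊗ ℝ)` — the frozen coordinate `δ` of ★ (3G) `exists_flat_gSide_centralCurve` ∕ the STEP-3
skeleton IS `cmRationalToArch L 1 Φ₁ γ_H.2` of `stub_ScCore`. [cite: Rogawski1990, §14.5 p. 239; §4.9 p. 54] [cite: BorelJacquet1979, §4.1] -/
theorem cmRationalToArch_one_eq_symm_circleDiagonal_of_coe_eq_smul_one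
    (γ₁ : (UnitaryGroup.cmDatum L 1 (Matrix.of fun i j : Fin 1 => if i.val + j.val + 1 = 1 then (1 : L) else 0)).Rational) {ζ : L}
    (hγ₁ : (((γ₁ : unitaryGroup (cmConjRingHom L) (Matrix.of fun i j : Fin 1 => if i.val + j.val + 1 = 1 then (1 : L) else 0)).val : GL (Fin 1) L) :
      Matrix (Fin 1) (Fin 1) L) = ζ • (1 : Matrix (Fin 1) (Fin 1) L)) :
    cmRationalToArch L 1 (Matrix.of fun i j : Fin 1 => if i.val + j.val + 1 = 1 then (1 : L) else 0) γ₁ =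
      (archPiEquivCM 1 L (Matrix.of fun i j : Fin 1 => if i.val + j.val + 1 = 1 then (1 : L) else 0)).symm fun w =>
        ⟨circleDiagonal 1 ![(⟨w.1.embedding ζ, mem_sphere_zero_iff_norm.mpr (norm_embedding_eq_one_of_coe_eq_smul_one γ₁ hγ₁ w)⟩ : Circle)],
          circleDiagonal_mem_archLocal_antidiagOne L w _⟩ := by
  apply (archPiEquivCM 1 L (Matrix.of fun i j : Fin 1 => if i.val + j.val + 1 = 1 then (1 : L) else 0)).injective
  rw [ContinuousMulEquiv.apply_symm_apply]
  funext w
  apply Subtype.ext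
  refine Matrix.GeneralLinearGroup.ext fun i j => ?_
  change evalC L w (mixedEmbedding L ((((γ₁ : unitaryGroup (cmConjRingHom L) (Matrix.of fun i j : Fin 1 => if i.val + j.val + 1 = 1 then (1 : L) else 0)).val :
      GL (Fin 1) L) : Matrix (Fin 1) (Fin 1) L) i j)) = (circleDiagonal 1 ![(⟨w.1.embedding ζ, mem_sphere_zero_iff_norm.mpr (norm_embedding_eq_one_of_coe_eq_smul_one γ₁ hγ₁ w)⟩ : Circle)] :
        Matrix (Fin 1) (Fin 1) ℂ) i j
  rw [hγ₁, coe_circleDiagonal, Subsingleton.elim i 0, Subsingleton.elim j 0]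
  simp [mixedEmbedding_apply_isComplex]

variable {α : Fin 2 → L} (T : GL (Fin 2) (mixedSpace L))
  (ψ : UnitaryGroup.arch (↥(maximalRealSubfield L)) L (IsCMField.complexConj L) 2 (Matrix.of fun i j : Fin 2 => if i.val + j.val + 1 = 2 then (1 : L) else 0) ≃ₜ*
    UnitaryGroup.arch (↥(maximalRealSubfield L)) L (IsCMField.complexConj L) 2 (Matrix.diagonal α))
  (hψ : ∀ x, ((ψ x : UnitaryGroup.arch (↥(maximalRealSubfield L)) L (IsCMField.complexConj L) 2 (Matrix.diagonal α)) : GL (Fin 2) (mixedSpace L)) =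
    T * (x : GL (Fin 2) (mixedSpace L)) * T⁻¹)

include hψ in
/-- **THE 2-BLOCK OF THE CENTRE IS THE CONSTANT TORUS POINT**: for `γ₂ = ζ•1₂ ∈ U(Φ₂)(L⁺)` with `|σ_w ζ| = 1`, `ψ((ζ•1₂) ⊗ 1) = t(w ↦ (σ_w ζ, σ_w ζ))` — a congruence fixes scalars (★ `conj_smul_one_eq`),
and a scalar `⊗ 1` is the constant torus point (cf. ★ `rationalToArch_eq_archDiagTorus_const`).  With ★ (3A′) `exists_contDiff_twoBlock` this reads `Θ₂(centre) = aH((ζ•1₂) ⊗ 1, δ)`, the value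
`stub_ScCore` speaks about. [cite: Rogawski1990, §14.5 p. 239; §8.4 p. 126] [cite: BorelJacquet1979, §4.1] -/
theorem congr_cmRationalToArch_two_eq_archDiagTorus_of_coe_eq_smul_one
    (γ₂ : (UnitaryGroup.cmDatum L 2 (Matrix.of fun i j : Fin 2 => if i.val + j.val + 1 = 2 then (1 : L) else 0)).Rational) {ζ : L}
    (hγ₂ : (((γ₂ : unitaryGroup (cmConjRingHom L) (Matrix.of fun i j : Fin 2 => if i.val + j.val + 1 = 2 then (1 : L) else 0)).val : GL (Fin 2) L) :
      Matrix (Fin 2) (Fin 2) L) = ζ • (1 : Matrix (Fin 2) (Fin 2) L))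
    (hζ : ∀ w : {w : InfinitePlace L // IsComplex w}, ‖w.1.embedding ζ‖ = 1) :
    ψ (cmRationalToArch L 2 (Matrix.of fun i j : Fin 2 => if i.val + j.val + 1 = 2 then (1 : L) else 0) γ₂) =
      archDiagTorus L 2 α (fun w _ => ⟨w.1.embedding ζ, mem_sphere_zero_iff_norm.mpr (hζ w)⟩) := by
  -- the congruence fixes the scalar
  have hsc : ((cmRationalToArch L 2 (Matrix.of fun i j : Fin 2 => if i.val + j.val + 1 = 2 then (1 : L) else 0) γ₂ : GL (Fin 2) (mixedSpace L)) :
      Matrix (Fin 2) (Fin 2) (mixedSpace L)) = mixedEmbedding L ζ • (1 : Matrix (Fin 2) (Fin 2) (mixedSpace L)) := by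
    change ((((γ₂ : unitaryGroup (cmConjRingHom L) (Matrix.of fun i j : Fin 2 => if i.val + j.val + 1 = 2 then (1 : L) else 0)).val : GL (Fin 2) L) :
      Matrix (Fin 2) (Fin 2) L)).map (mixedEmbedding L) = _
    rw [hγ₂, Matrix.map_smul' _ _ _ (map_mul (mixedEmbedding L)), Matrix.map_one _ (map_zero _) (map_one _)]
  have hx : ((ψ (cmRationalToArch L 2 (Matrix.of fun i j : Fin 2 => if i.val + j.val + 1 = 2 then (1 : L) else 0) γ₂) :
        UnitaryGroup.arch (↥(maximalRealSubfield L)) L (IsCMField.complexConj L) 2 (Matrix.diagonal α)) : GL (Fin 2) (mixedSpace L)) =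
      (cmRationalToArch L 2 (Matrix.of fun i j : Fin 2 => if i.val + j.val + 1 = 2 then (1 : L) else 0) γ₂ : GL (Fin 2) (mixedSpace L)) := by
    rw [hψ]
    exact conj_smul_one_eq T hsc
  -- compare place by place
  apply (archPiEquivCM 2 L (Matrix.diagonal α)).injective
  funext w
  rw [archPiEquivCM_archDiagTorus]
  apply Subtype.ext
  refine Matrix.GeneralLinearGroup.ext fun i j => ?_
  change evalC L w ((((ψ (cmRationalToArch L 2 (Matrix.of fun i j : Fin 2 => if i.val + j.val + 1 = 2 then (1 : L) else 0) γ₂) :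
        UnitaryGroup.arch (↥(maximalRealSubfield L)) L (IsCMField.complexConj L) 2 (Matrix.diagonal α)) : GL (Fin 2) (mixedSpace L)) : Matrix (Fin 2) (Fin 2) (mixedSpace L)) i j) =
    (circleDiagonal 2 (fun _ => (⟨w.1.embedding ζ, mem_sphere_zero_iff_norm.mpr (hζ w)⟩ : Circle)) : Matrix (Fin 2) (Fin 2) ℂ) i j
  rw [hx, hsc, coe_circleDiagonal, Matrix.smul_apply, evalC_apply]
  by_cases hij : i = j
  · subst hij
    simp [mixedEmbedding_apply_isComplex]
  · simp [hij, Matrix.one_apply_ne hij]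

end Centre

end Literature.NumberTheory.Rogawski1990

end
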